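import Mathlib
import Literature.Geometry.DiscreteGeometry.LegendreThreePSD
import Summits.AtomisticToContinuum.Crystallization.Theses.EnergyDerivativeOrder
import Summits.AtomisticToContinuum.Crystallization.Theorems.EnergyDerivativeOrderGappedKissingBoundDegree
import HarnessLib

/-!
# Route EnergyDerivativeOrder — item `GappedKissingBound` (stmt-AtomisticToContinuum-12281)

**Claim.** At most `12` points of `ℝ³` lie at distance within `1/400` of `1` from a centre `c` if
their mutual distances are either within `1/400` of `1` ("bond") or at least `√2 − 1/100`.

**Proof (unconditional; no named fact).**
1. *Projection* (`gkb_normalised_inner_alternative`): the unit vectors `u p = (p − c)/‖p − c‖`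
   have pairwise inner products `≤ 1/50` (angle `≥ 88.85°`) or in `[247/500, 253/500]`
   (`60° ± 0.4°`) — elementary estimates on `(R² + S² − D²)/(2RS)` for `R, S ∈ [399/400, 401/400]`.
2. *Local constraint* (`gkb_bond_card_le_four`, file `…GappedKissingBoundDegree.lean`): every
   point has at most four bonded partners (five azimuthal gaps `> 3π/8` around a bond circle,
   all `< 2π/5` or one `> π/2`, cannot sum to `2π`).
3. *Delsarte's linear programme with that one extra constraint* (`gkb_card_le_twelve_of_gapped`):
   with `G(t) = (t − 1/50)(t + 7/10)² = 0.4502 + 1.062 P₁ + 0.92 P₂ + 0.4 P₃` one has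
   `Σ_{p,q} G(⟪u p, u q⟫) ≥ 0.4502 N²` (Legendre positivity on `S²`,
   `Literature.Geometry.DiscreteGeometry.sum_sum_legendreI_nonneg`), while `G ≤ 0` on the far
   range and `G ≤ 0.707` on the bond range give `Σ_{p,q} G ≤ N (G(1) + 4 · 0.707) = 5.6602 N`;
   hence `N ≤ 12.57`.

Remarks. The pure Delsarte bound for the gapped set `[-1, 0.02] ∪ [0.494, 0.506]` is `13.29`
(its optimal dual measure already lives on the gapped set), so the counting constraint of step 2
is what brings the bound below `13`; with it a cubic suffices (degree `4` gives `12.32`,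
degree `10` gives `12.30`). The angular tolerance handled here (`59.6°`) is below the `60°` of the
tree's kissing theorem `musin2006_kissing_three_holds`, and no appeal to the (unproved, named)
Tammes-13 fact `musinTarasov2012_tammes_thirteen` is made.
-/

noncomputable section

namespace Summit.AtomisticToContinuum.Crystallization.Theorems

open Real Finset Literature.Geometry.DiscreteGeometry
open scoped RealInnerProductSpace

/-! ### Legendre positivity in degrees `1, 2, 3` -/

/-- `legendreI 1 s q = 2 s` (`= 2 P₁`). [folklore] -/
theorem gkb_legendreI_one (s q : ℝ) : legendreI 1 s q = 2 * s := by
  simp [legendreI]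

/-- `legendreI 2 s q = 6 s² − 2 q` (`= 4 P₂` at `q = 1`). [folklore] -/
theorem gkb_legendreI_two (s q : ℝ) : legendreI 2 s q = 6 * s ^ 2 - 2 * q := by
  simp [legendreI, Finset.sum_range_succ]
  norm_num [Nat.choose]
  ring

/-- `legendreI 3 s q = 20 s³ − 12 s q` (`= 8 P₃` at `q = 1`). [folklore] -/
theorem gkb_legendreI_three (s q : ℝ) : legendreI 3 s q = 20 * s ^ 3 - 12 * s * q := by
  simp [legendreI, Finset.sum_range_succ]
  norm_num [Nat.choose]
  ring

/-- **Delsarte's inequalities** `Σ_p Σ_q P_k(⟪u p, u q⟫) ≥ 0` for `k = 1, 2, 3` and unit vectors of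
`ℝ³` (positive definiteness of the Legendre polynomials, `sum_sum_legendreI_nonneg`). [folklore] -/
theorem gkb_legendre_sums_nonneg {ι : Type*} (T : Finset ι) (u : ι → EuclideanSpace ℝ (Fin 3))
    (h1 : ∀ p ∈ T, ‖u p‖ = 1) :
    0 ≤ ∑ p ∈ T, ∑ q ∈ T, ⟪u p, u q⟫ ∧
    0 ≤ ∑ p ∈ T, ∑ q ∈ T, (3 * ⟪u p, u q⟫ ^ 2 - 1) ∧
    0 ≤ ∑ p ∈ T, ∑ q ∈ T, (5 * ⟪u p, u q⟫ ^ 3 - 3 * ⟪u p, u q⟫) := by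
  have H := fun k => sum_sum_legendreI_nonneg k T (fun _ => (1 : ℝ)) u
  have E1 : ∑ p ∈ T, ∑ q ∈ T, (1 : ℝ) * 1 * legendreI 1 ⟪u p, u q⟫ (‖u p‖ ^ 2 * ‖u q‖ ^ 2) =
      2 * ∑ p ∈ T, ∑ q ∈ T, ⟪u p, u q⟫ := by
    rw [Finset.mul_sum]
    refine Finset.sum_congr rfl fun p _ => ?_
    rw [Finset.mul_sum]
    refine Finset.sum_congr rfl fun q _ => ?_
    rw [gkb_legendreI_one]; ring
  have E2 : ∑ p ∈ T, ∑ q ∈ T, (1 : ℝ) * 1 * legendreI 2 ⟪u p, u q⟫ (‖u p‖ ^ 2 * ‖u q‖ ^ 2) =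
      2 * ∑ p ∈ T, ∑ q ∈ T, (3 * ⟪u p, u q⟫ ^ 2 - 1) := by
    rw [Finset.mul_sum]
    refine Finset.sum_congr rfl fun p hp => ?_
    rw [Finset.mul_sum]
    refine Finset.sum_congr rfl fun q hq => ?_
    rw [gkb_legendreI_two, h1 p hp, h1 q hq]; ring
  have E3 : ∑ p ∈ T, ∑ q ∈ T, (1 : ℝ) * 1 * legendreI 3 ⟪u p, u q⟫ (‖u p‖ ^ 2 * ‖u q‖ ^ 2) =
      4 * ∑ p ∈ T, ∑ q ∈ T, (5 * ⟪u p, u q⟫ ^ 3 - 3 * ⟪u p, u q⟫) := by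
    rw [Finset.mul_sum]
    refine Finset.sum_congr rfl fun p hp => ?_
    rw [Finset.mul_sum]
    refine Finset.sum_congr rfl fun q hq => ?_
    rw [gkb_legendreI_three, h1 p hp, h1 q hq]; ring
  have H1 := H 1; have H2 := H 2; have H3 := H 3
  rw [E1] at H1; rw [E2] at H2; rw [E3] at H3
  exact ⟨by linarith, by linarith, by linarith⟩

/-! ### The auxiliary cubic `G(t) = (t − 1/50)(t + 7/10)²` -/

/-- Legendre expansion of the LP certificate `G(t) = (t − 1/50)(t + 7/10)²`:
`G = 0.4502 P₀ + 1.062 P₁ + 0.92 P₂ + 0.4 P₃` (all coefficients positive). [folklore] -/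
theorem gkb_legendre (t : ℝ) : (t - 1 / 50) * (t + 7 / 10) ^ 2 =
    2251 / 5000 + 531 / 500 * t + 23 / 50 * (3 * t ^ 2 - 1) + 1 / 5 * (5 * t ^ 3 - 3 * t) := by
  ring

/-- `G ≤ 0` on the far range `t ≤ 1/50`. [folklore] -/
theorem gkb_nonpos {t : ℝ} (ht : t ≤ 1 / 50) : (t - 1 / 50) * (t + 7 / 10) ^ 2 ≤ 0 :=
  mul_nonpos_of_nonpos_of_nonneg (by linarith) (sq_nonneg _)

/-- `G ≤ 0.707` on the bond range `[247/500, 253/500]` (`G(253/500) = 0.70685…`). [folklore] -/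
theorem gkb_le {t : ℝ} (h1 : (247 : ℝ) / 500 ≤ t) (h2 : t ≤ 253 / 500) :
    (t - 1 / 50) * (t + 7 / 10) ^ 2 ≤ 707 / 1000 := by
  have ha : t - 1 / 50 ≤ 243 / 500 := by linarith
  have hb : (t + 7 / 10) ^ 2 ≤ (603 / 500) ^ 2 := by nlinarith
  have := mul_le_mul ha hb (sq_nonneg _) (by norm_num)
  nlinarith

/-! ### The counting theorem -/

/-- **Gapped spherical codes on `S²` have at most twelve points.** If finitely many unit vectors of
`ℝ³` have pairwise inner products `≤ 1/50` or in `[247/500, 253/500]`, there are at most `12` of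
them. Proof (Delsarte LP with one counting constraint): `S = Σ_p Σ_q G(⟪u p, u q⟫)` for
`G(t) = (t − 1/50)(t + 7/10)²`; `S ≥ 0.4502 N²` by `gkb_legendre_sums_nonneg` and `gkb_legendre`,
and row by row `S ≤ N (G(1) + 4 · 0.707) = 5.6602 N` by `gkb_nonpos`, `gkb_le` and
`gkb_bond_card_le_four`; `5.6602 / 0.4502 = 12.57… < 13`. [folklore] -/
theorem gkb_card_le_twelve_of_gapped {ι : Type*} [DecidableEq ι] (T : Finset ι)
    (u : ι → EuclideanSpace ℝ (Fin 3)) (h1 : ∀ p ∈ T, ‖u p‖ = 1)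
    (hA : ∀ p ∈ T, ∀ q ∈ T, p ≠ q →
      ⟪u p, u q⟫ ≤ 1 / 50 ∨ (247 / 500 ≤ ⟪u p, u q⟫ ∧ ⟪u p, u q⟫ ≤ 253 / 500)) :
    T.card ≤ 12 := by
  classical
  obtain ⟨S1, S2, S3⟩ := gkb_legendre_sums_nonneg T u h1
  -- lower bound
  have hlow : (2251 : ℝ) / 5000 * (T.card : ℝ) ^ 2 ≤
      ∑ p ∈ T, ∑ q ∈ T, (⟪u p, u q⟫ - 1 / 50) * (⟪u p, u q⟫ + 7 / 10) ^ 2 := by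
    have hsum : ∑ p ∈ T, ∑ q ∈ T, (⟪u p, u q⟫ - 1 / 50) * (⟪u p, u q⟫ + 7 / 10) ^ 2 =
        ∑ p ∈ T, ∑ q ∈ T, (2251 : ℝ) / 5000
        + 531 / 500 * ∑ p ∈ T, ∑ q ∈ T, ⟪u p, u q⟫
        + 23 / 50 * ∑ p ∈ T, ∑ q ∈ T, (3 * ⟪u p, u q⟫ ^ 2 - 1)
        + 1 / 5 * ∑ p ∈ T, ∑ q ∈ T, (5 * ⟪u p, u q⟫ ^ 3 - 3 * ⟪u p, u q⟫) := by
      simp only [gkb_legendre, Finset.sum_add_distrib, ← Finset.mul_sum]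
    have h0 : ∑ p ∈ T, ∑ q ∈ T, (2251 : ℝ) / 5000 = 2251 / 5000 * (T.card : ℝ) ^ 2 := by
      simp [sq]; ring
    rw [hsum, h0]
    nlinarith
  -- row bound
  have hrow : ∀ p ∈ T,
      ∑ q ∈ T, (⟪u p, u q⟫ - 1 / 50) * (⟪u p, u q⟫ + 7 / 10) ^ 2 ≤ 14161 / 5000 + 4 * (707 / 1000) := by
    intro p hp
    rw [← Finset.add_sum_erase T _ hp]
    have hpp : (⟪u p, u p⟫ - 1 / 50) * (⟪u p, u p⟫ + 7 / 10) ^ 2 = 14161 / 5000 := by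
      rw [real_inner_self_eq_norm_sq, h1 p hp]; norm_num
    rw [hpp]
    set R := T.erase p with hR
    rw [← Finset.sum_filter_add_sum_filter_not R (fun q => (247 : ℝ) / 500 ≤ ⟪u p, u q⟫)]
    have hRT : ∀ q ∈ R, q ∈ T ∧ p ≠ q := fun q hq =>
      ⟨Finset.mem_of_mem_erase hq, (Finset.ne_of_mem_erase hq).symm⟩
    have hbond : ∑ q ∈ R.filter (fun q => (247 : ℝ) / 500 ≤ ⟪u p, u q⟫),
        (⟪u p, u q⟫ - 1 / 50) * (⟪u p, u q⟫ + 7 / 10) ^ 2 ≤ 4 * (707 / 1000) := by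
      calc ∑ q ∈ R.filter (fun q => (247 : ℝ) / 500 ≤ ⟪u p, u q⟫),
            (⟪u p, u q⟫ - 1 / 50) * (⟪u p, u q⟫ + 7 / 10) ^ 2
          ≤ ∑ q ∈ R.filter (fun q => (247 : ℝ) / 500 ≤ ⟪u p, u q⟫), (707 : ℝ) / 1000 := by
            refine Finset.sum_le_sum fun q hq => ?_
            obtain ⟨hqR, hqb⟩ := Finset.mem_filter.mp hq
            obtain ⟨hqT, hpq⟩ := hRT q hqR
            rcases hA p hp q hqT hpq with h | h
            · linarith
            · exact gkb_le h.1 h.2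
        _ = ((R.filter (fun q => (247 : ℝ) / 500 ≤ ⟪u p, u q⟫)).card : ℝ) * (707 / 1000) := by
            rw [Finset.sum_const, nsmul_eq_mul]
        _ ≤ 4 * (707 / 1000) := by
            have h4 := gkb_bond_card_le_four T u h1 hA p hp
            have h4' : ((R.filter (fun q => (247 : ℝ) / 500 ≤ ⟪u p, u q⟫)).card : ℝ) ≤ 4 := by
              rw [hR]; exact_mod_cast h4
            nlinarith
    have hfar : ∑ q ∈ R.filter (fun q => ¬ (247 : ℝ) / 500 ≤ ⟪u p, u q⟫),
        (⟪u p, u q⟫ - 1 / 50) * (⟪u p, u q⟫ + 7 / 10) ^ 2 ≤ 0 := by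
      apply Finset.sum_nonpos
      intro q hq
      obtain ⟨hqR, hqb⟩ := Finset.mem_filter.mp hq
      obtain ⟨hqT, hpq⟩ := hRT q hqR
      rcases hA p hp q hqT hpq with h | h
      · exact gkb_nonpos h
      · exact absurd h.1 hqb
    linarith
  have hup : ∑ p ∈ T, ∑ q ∈ T, (⟪u p, u q⟫ - 1 / 50) * (⟪u p, u q⟫ + 7 / 10) ^ 2 ≤
      (T.card : ℝ) * (14161 / 5000 + 4 * (707 / 1000)) := by
    have := Finset.sum_le_sum hrow
    rw [Finset.sum_const, nsmul_eq_mul] at this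
    exact this
  have hc : (2251 : ℝ) / 5000 * (T.card : ℝ) ^ 2 ≤
      (T.card : ℝ) * (14161 / 5000 + 4 * (707 / 1000)) := hlow.trans hup
  by_contra hbig
  push Not at hbig
  have h13 : (13 : ℝ) ≤ T.card := by exact_mod_cast hbig
  nlinarith

/-! ### From the shell to the sphere -/

/-- **Projection step.** For `x, y` of norm in `[399/400, 401/400]` with `‖x − y‖` either in
`[399/400, 401/400]` or `≥ √2 − 1/100`, the inner product of the normalised vectors
`I / (‖x‖ ‖y‖)`, `I = (‖x‖² + ‖y‖² − ‖x − y‖²)/2`, is `≤ 1/50` or in `[247/500, 253/500]`.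
[folklore] -/
theorem gkb_normalised_inner_alternative {R S D I : ℝ} (hR1 : (399 : ℝ) / 400 ≤ R)
    (hR2 : R ≤ 401 / 400)
    (hS1 : (399 : ℝ) / 400 ≤ S) (hS2 : S ≤ 401 / 400) (hI : D ^ 2 = R ^ 2 - 2 * I + S ^ 2)
    (hD : ((399 : ℝ) / 400 ≤ D ∧ D ≤ 401 / 400) ∨ Real.sqrt 2 - 1 / 100 ≤ D) :
    R⁻¹ * (S⁻¹ * I) ≤ 1 / 50 ∨
      ((247 : ℝ) / 500 ≤ R⁻¹ * (S⁻¹ * I) ∧ R⁻¹ * (S⁻¹ * I) ≤ 253 / 500) := by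
  have hR0 : 0 < R := by linarith
  have hS0 : 0 < S := by linarith
  have hRS : 0 < R * S := mul_pos hR0 hS0
  have hJ : R⁻¹ * (S⁻¹ * I) = I / (R * S) := by
    field_simp
  rw [hJ]
  have pRS : 0 ≤ (R - 399 / 400) * (S - 399 / 400) := mul_nonneg (by linarith) (by linarith)
  rcases hD with ⟨hD1, hD2⟩ | hD
  · right
    have hD0 : 0 ≤ D := by linarith
    have hDsq1 : (399 / 400 : ℝ) ^ 2 ≤ D ^ 2 := by nlinarith
    have hDsq2 : D ^ 2 ≤ (401 / 400 : ℝ) ^ 2 := by nlinarith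
    constructor
    · rw [le_div_iff₀ hRS]
      have p1 : 0 ≤ (R - 399 / 400) * (R + 399 / 400 - 988 / 1000 * S) :=
        mul_nonneg (by linarith) (by linarith)
      have p2 : 0 ≤ (S - 399 / 400) * (S + 399 / 400 - 988 / 1000 * (399 / 400)) :=
        mul_nonneg (by linarith) (by linarith)
      nlinarith
    · rw [div_le_iff₀ hRS]
      have p1 : 0 ≤ (R - 399 / 400) * (401 / 400 - R) := mul_nonneg (by linarith) (by linarith)
      have p2 : 0 ≤ (S - 399 / 400) * (401 / 400 - S) := mul_nonneg (by linarith) (by linarith)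
      nlinarith
  · left
    rw [div_le_iff₀ hRS]
    have hsqrt : (141421 : ℝ) / 100000 ≤ Real.sqrt 2 := by
      rw [Real.le_sqrt (by norm_num) (by norm_num)]; norm_num
    have hD1 : (140421 : ℝ) / 100000 ≤ D := by linarith
    have hDsq : (19718 : ℝ) / 10000 ≤ D ^ 2 := by nlinarith
    have p1 : 0 ≤ (401 / 400 - R) * (401 / 400 + R) := mul_nonneg (by linarith) (by linarith)
    have p2 : 0 ≤ (401 / 400 - S) * (401 / 400 + S) := mul_nonneg (by linarith) (by linarith)
    nlinarith

/-- **The gapped kissing bound** (item `stmt-AtomisticToContinuum-12281`, route decl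
`EnergyDerivativeOrder.GappedKissingBound`): at most `12` points lie at distance within `1/400`
of `1` from a centre `c` if their mutual distances are within `1/400` of `1` or at least
`√2 − 1/100`. Proof: normalise `p ↦ (p − c)/‖p − c‖`; by `gkb_normalised_inner_alternative` the
unit vectors have pairwise inner products `≤ 1/50` or in `[247/500, 253/500]` (angles `≥ 88.85°` or
`60° ± 0.4°`), and `gkb_card_le_twelve_of_gapped` applies (Delsarte's LP bound with the cubic
`(t − 1/50)(t + 7/10)²` plus the local constraint "at most four bonds per point", value
`12.57 < 13`). [folklore] -/
theorem gappedKissingBound_proof :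
    Summit.AtomisticToContinuum.Crystallization.Theses.EnergyDerivativeOrder.GappedKissingBound := by
  unfold Summit.AtomisticToContinuum.Crystallization.Theses.EnergyDerivativeOrder.GappedKissingBound
  intro c T hrad hdist
  classical
  set u : EuclideanSpace ℝ (Fin 3) → EuclideanSpace ℝ (Fin 3) := fun p => ‖p - c‖⁻¹ • (p - c)
    with hu
  have hnorm : ∀ p ∈ T, (399 : ℝ) / 400 ≤ ‖p - c‖ ∧ ‖p - c‖ ≤ 401 / 400 := fun p hp => by
    rw [← dist_eq_norm]; exact hrad p hp
  have h1 : ∀ p ∈ T, ‖u p‖ = 1 := by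
    intro p hp
    have hp0 : 0 < ‖p - c‖ := by linarith [(hnorm p hp).1]
    rw [hu]
    simp only [norm_smul, norm_inv, norm_norm]
    exact inv_mul_cancel₀ hp0.ne'
  have hA : ∀ p ∈ T, ∀ q ∈ T, p ≠ q →
      ⟪u p, u q⟫ ≤ 1 / 50 ∨ (247 / 500 ≤ ⟪u p, u q⟫ ∧ ⟪u p, u q⟫ ≤ 253 / 500) := by
    intro p hp q hq hpq
    obtain ⟨hR1, hR2⟩ := hnorm p hp
    obtain ⟨hS1, hS2⟩ := hnorm q hq
    have hd := hdist p hp q hq hpq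
    rw [dist_eq_norm] at hd
    have hI : ‖p - q‖ ^ 2 = ‖p - c‖ ^ 2 - 2 * ⟪p - c, q - c⟫ + ‖q - c‖ ^ 2 := by
      rw [← norm_sub_sq_real]; congr 1; abel
    have key := gkb_normalised_inner_alternative hR1 hR2 hS1 hS2 hI hd
    have hinner : ⟪u p, u q⟫ = ‖p - c‖⁻¹ * (‖q - c‖⁻¹ * ⟪p - c, q - c⟫) := by
      rw [hu]; simp only [real_inner_smul_left, real_inner_smul_right]; ring
    rw [hinner]
    exact key
  exact gkb_card_le_twelve_of_gapped T u h1 hA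

end Summit.AtomisticToContinuum.Crystallization.Theorems

end
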